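import Mathlib.Data.ZMod.Basic
import Mathlib.Tactic
import HarnessLib

/-!
# The Hecke descent sequence `c_0 = 1, c_1 = a_p, c_{j+2} = a_p c_{j+1} − p c_j` and its three regimes
# (cell `b2b-bsdres`, supersingular family, prover B = unit `b2b-bsdres-additive-p3`, gen 9; part 1a)

HONEST FRAMING (run/shared/lean/b2b/bsd-rank1-residual/, verbatim in every file): the goal of the
cell is to DELETE the COMBINATION-SHAPED residual classes of the Birch–Swinnerton-Dyer formula for
ALL analytic-rank `≤ 1` elliptic curves over `ℚ` — "full BSD formula for every rank `≤ 1` curve in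
class `C`" assembled STRICTLY from published theorems — so that the rank-`≤ 1` remainder becomes
exactly the CONSTRUCTION-SHAPED classes, which are TYPED (missing-input `Prop`s), NOT attempted.
This is not "finishing BSD". THEOREMS ONLY (no definition, no named fact, no `sorry`); elementary
algebra, nothing about any curve.

## What this file proves, and why

The Mazur–Tate element `θ_n` of a rational newform `f` (`p ∤ N`, `a_p(f) = a_p`) evaluated at a
character of a LOWER layer `k + 1 ≤ n` is `c_{n−k−1}` times the Birch sum of that character
(part 1b, `MazurTateHeckeDescent.lean`, from the tree's three-term relation), where
`c_0 = 1`, `c_1 = a_p`, `c_{j+2} = a_p c_{j+1} − p c_j` is the Lucas sequence of the Hecke polynomial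
`X² − a_p X + p` (`c_j = (α^{j+1} − β^{j+1})/(α − β)`). This file is the elementary algebra of that
sequence, carried through HYPOTHESES `hc0, hc1, hrec` on a function `c : ℕ → ℤ` (no definition):
existence and uniqueness; **ordinary** `p ∤ a_p` ⇒ `c_j ≡ a_p^j (mod p)`, never zero; **`a_p = 0`** ⇒
`c_{2i} = (−p)^i`, `c_{2i+1} = 0` (the classical "trivial zeros" of `θ_n` at the layers of the other
parity); **X8, `p = 3`, `a_3 = ±3`** ⇒ `c_2, …, c_7 = 6, 3a_3, 9, 0, −27, −27a_3`, the period-six law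
**`c_{j+6} = −27·c_j`** (`α⁶ = −27`), `c_{6q+s} = (−27)^q c_s`, and **`c_j = 0 ↔ j ≡ 5 (mod 6)`** — so an
X8 Mazur–Tate element `θ_n` has FORCED zeros exactly at the layers `n − 5, n − 11, …`.

References: B. Mazur, J. Tate, J. Teitelbaum, Invent. Math. 84 (1986) §I.10 (10.2)
[MazurTateTeitelbaum1986Invent] (the three-term relation whose evaluation produces `c`).
Memo: `HOME/b2b-bsdres-additive-p3/X8-ROUTE-B.md` §14 (gen 9).
-/

set_option autoImplicit false

namespace Summit.BirchSwinnertonDyer.Rank1Residual.Supersingular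

/-! ## §1. The Hecke descent sequence `c_0 = 1, c_1 = a_p, c_{j+2} = a_p c_{j+1} − p c_j` -/

section Sequence

/-- **The Hecke descent sequence exists** (trivially, by recursion): for all `a_p ∈ ℤ` and `p` there is
`c : ℕ → ℤ` with `c_0 = 1`, `c_1 = a_p`, `c_{j+2} = a_p c_{j+1} − p c_j` — the Lucas sequence of the
Hecke polynomial `X² − a_p X + p`, `c_j = (α^{j+1} − β^{j+1})/(α − β)`. The theorems below carry
`c` through the hypotheses `hc0, hc1, hrec` (no definition is introduced). [folklore] -/
theorem exists_heckeDescentSeq (ap : ℤ) (p : ℕ) :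
    ∃ c : ℕ → ℤ, c 0 = 1 ∧ c 1 = ap ∧ ∀ j, c (j + 2) = ap * c (j + 1) - p * c j := by
  let g : ℕ → ℤ × ℤ := fun j ↦ Nat.rec ((1 : ℤ), ap) (fun _ v ↦ (v.2, ap * v.2 - p * v.1)) j
  refine ⟨fun j ↦ (g j).1, rfl, ?_, fun j ↦ ?_⟩
  · rfl
  · rfl

/-- Two solutions of the recursion with the same initial values agree. [folklore] -/
theorem heckeDescentSeq_unique {ap : ℤ} {p : ℕ} {c c' : ℕ → ℤ} (hc0 : c 0 = 1) (hc1 : c 1 = ap)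
    (hrec : ∀ j, c (j + 2) = ap * c (j + 1) - p * c j) (hc0' : c' 0 = 1) (hc1' : c' 1 = ap)
    (hrec' : ∀ j, c' (j + 2) = ap * c' (j + 1) - p * c' j) : c = c' := by
  have key : ∀ j, c j = c' j ∧ c (j + 1) = c' (j + 1) := by
    intro j
    induction j with
    | zero => exact ⟨hc0.trans hc0'.symm, hc1.trans hc1'.symm⟩
    | succ j ih => exact ⟨ih.2, by rw [hrec, hrec', ih.1, ih.2]⟩
  exact funext fun j ↦ (key j).1

/-- **Ordinary regime**: `c_j ≡ a_p^j (mod p)` — each step multiplies by `a_p` modulo `p`. [folklore] -/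
theorem heckeDescentSeq_intCast_zmod_eq_pow {ap : ℤ} {p : ℕ} {c : ℕ → ℤ} (hc0 : c 0 = 1)
    (hc1 : c 1 = ap) (hrec : ∀ j, c (j + 2) = ap * c (j + 1) - p * c j) (j : ℕ) :
    ((c j : ℤ) : ZMod p) = ((ap : ℤ) : ZMod p) ^ j := by
  have key : ∀ j, ((c j : ℤ) : ZMod p) = ((ap : ℤ) : ZMod p) ^ j ∧
      ((c (j + 1) : ℤ) : ZMod p) = ((ap : ℤ) : ZMod p) ^ (j + 1) := by
    intro j
    induction j with
    | zero => exact ⟨by rw [hc0, Int.cast_one, pow_zero], by rw [hc1, pow_one]⟩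
    | succ j ih =>
      refine ⟨ih.2, ?_⟩
      rw [hrec, Int.cast_sub, Int.cast_mul, Int.cast_mul, ih.2, Int.cast_natCast, ZMod.natCast_self,
        zero_mul, sub_zero]
      ring
  exact (key j).1

/-- **Ordinary regime: no term vanishes.** If `p` is a prime with `p ∤ a_p` then `c_j ≠ 0` for all `j`
(indeed `p ∤ c_j`). [folklore] -/
theorem heckeDescentSeq_ne_zero_of_not_dvd {ap : ℤ} {p : ℕ} [hp : Fact p.Prime] {c : ℕ → ℤ}
    (hc0 : c 0 = 1) (hc1 : c 1 = ap) (hrec : ∀ j, c (j + 2) = ap * c (j + 1) - p * c j)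
    (hap : ¬ (p : ℤ) ∣ ap) (j : ℕ) : c j ≠ 0 := by
  intro h0
  have h := heckeDescentSeq_intCast_zmod_eq_pow hc0 hc1 hrec j
  rw [h0, Int.cast_zero] at h
  have hu : ((ap : ℤ) : ZMod p) ≠ 0 := by
    rwa [Ne, ZMod.intCast_zmod_eq_zero_iff_dvd]
  exact pow_ne_zero j hu h.symm

/-- **`a_p = 0` regime**: `c_{2i} = (−p)^i` and `c_{2i+1} = 0` — the odd-distance layers are the
"trivial zeros" of the Mazur–Tate elements at `a_p = 0` (Kurihara, Pollack: `ω_n^∓ ∣ θ_n`). [folklore] -/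
theorem heckeDescentSeq_of_ap_eq_zero {p : ℕ} {c : ℕ → ℤ} (hc0 : c 0 = 1) (hc1 : c 1 = 0)
    (hrec : ∀ j, c (j + 2) = 0 * c (j + 1) - p * c j) (i : ℕ) :
    c (2 * i) = (-(p : ℤ)) ^ i ∧ c (2 * i + 1) = 0 := by
  induction i with
  | zero => exact ⟨by rw [mul_zero, hc0, pow_zero], by rw [mul_zero, zero_add, hc1]⟩
  | succ i ih =>
    constructor
    · rw [show 2 * (i + 1) = 2 * i + 2 by ring, hrec, zero_mul, zero_sub, ih.1, pow_succ]; ring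
    · rw [show 2 * (i + 1) + 1 = (2 * i + 1) + 2 by ring, hrec, zero_mul, zero_sub, ih.2, mul_zero,
        neg_zero]

/-- `a_p = 0`: `c_j = 0 ↔ j` is odd (`p ≠ 0`). [folklore] -/
theorem heckeDescentSeq_eq_zero_iff_odd_of_ap_eq_zero {p : ℕ} (hp : p ≠ 0) {c : ℕ → ℤ}
    (hc0 : c 0 = 1) (hc1 : c 1 = 0) (hrec : ∀ j, c (j + 2) = 0 * c (j + 1) - p * c j) (j : ℕ) :
    c j = 0 ↔ Odd j := by
  rcases Nat.even_or_odd j with ⟨i, rfl⟩ | ⟨i, rfl⟩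
  · rw [← two_mul, (heckeDescentSeq_of_ap_eq_zero hc0 hc1 hrec i).1]
    simp only [ne_eq, pow_eq_zero_iff', neg_eq_zero, Nat.cast_eq_zero, hp, false_and, false_iff,
      Nat.not_odd_iff_even, even_two_mul]
  · rw [(heckeDescentSeq_of_ap_eq_zero hc0 hc1 hrec i).2]
    simp only [true_iff]
    exact odd_two_mul_add_one i

/-- **X8 regime (`p = 3`, `a_3 = ±3`): the first terms** `c_2 = 6`, `c_3 = 3a_3`, `c_4 = 9`, `c_5 = 0`,
`c_6 = −27`, `c_7 = −27·a_3`. [folklore] -/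
theorem heckeDescentSeq_values_of_three {a : ℤ} (ha : a ^ 2 = 9) {c : ℕ → ℤ} (hc0 : c 0 = 1)
    (hc1 : c 1 = a) (hrec : ∀ j, c (j + 2) = a * c (j + 1) - (3 : ℕ) * c j) :
    c 2 = 6 ∧ c 3 = 3 * a ∧ c 4 = 9 ∧ c 5 = 0 ∧ c 6 = -27 ∧ c 7 = -27 * a := by
  have h2 : c 2 = 6 := by rw [hrec 0, hc1, hc0]; push_cast; nlinarith
  have h3 : c 3 = 3 * a := by rw [hrec 1, h2, hc1]; push_cast; ring
  have h4 : c 4 = 9 := by rw [hrec 2, h3, h2]; push_cast; nlinarith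
  have h5 : c 5 = 0 := by rw [hrec 3, h4, h3]; push_cast; ring
  have h6 : c 6 = -27 := by rw [hrec 4, h5, h4]; push_cast; ring
  have h7 : c 7 = -27 * a := by rw [hrec 5, h6, h5]; push_cast; ring
  exact ⟨h2, h3, h4, h5, h6, h7⟩

/-- **X8 regime: the period-six law `c_{j+6} = −27·c_j`** (`p = 3`, `a_3² = 9`; the roots of
`X² ∓ 3X + 3` are `√3·e^{±iπ/6}` up to sign, so `α⁶ = β⁶ = −27`): the sequence `c_{j+6} + 27c_j`
solves the recursion with initial values `c_6 + 27 = 0`, `c_7 + 27a_3 = 0`. [folklore] -/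
theorem heckeDescentSeq_add_six_of_three {a : ℤ} (ha : a ^ 2 = 9) {c : ℕ → ℤ} (hc0 : c 0 = 1)
    (hc1 : c 1 = a) (hrec : ∀ j, c (j + 2) = a * c (j + 1) - (3 : ℕ) * c j) (j : ℕ) :
    c (j + 6) = -27 * c j := by
  obtain ⟨-, -, -, -, h6, h7⟩ := heckeDescentSeq_values_of_three ha hc0 hc1 hrec
  have key : ∀ j, c (j + 6) = -27 * c j ∧ c (j + 7) = -27 * c (j + 1) := by
    intro j
    induction j with
    | zero => exact ⟨by rw [zero_add, h6, hc0, mul_one], by rw [zero_add, h7, zero_add, hc1]⟩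
    | succ j ih =>
      refine ⟨by rw [show j + 1 + 6 = j + 7 by ring]; exact ih.2, ?_⟩
      rw [show j + 1 + 7 = (j + 6) + 2 by ring, hrec (j + 6), show j + 6 + 1 = j + 7 by ring, ih.1,
        ih.2, show j + 1 + 1 = j + 2 by ring, hrec j]
      ring
  exact (key j).1

/-- **X8 regime: closed form along residues** `c_{6q + s} = (−27)^q · c_s`. [folklore] -/
theorem heckeDescentSeq_six_mul_add_of_three {a : ℤ} (ha : a ^ 2 = 9) {c : ℕ → ℤ} (hc0 : c 0 = 1)
    (hc1 : c 1 = a) (hrec : ∀ j, c (j + 2) = a * c (j + 1) - (3 : ℕ) * c j) (q s : ℕ) :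
    c (6 * q + s) = (-27) ^ q * c s := by
  induction q with
  | zero => rw [mul_zero, zero_add, pow_zero, one_mul]
  | succ q ih =>
    rw [show 6 * (q + 1) + s = (6 * q + s) + 6 by ring, heckeDescentSeq_add_six_of_three ha hc0 hc1 hrec,
      ih, pow_succ]
    ring

/-- **X8 regime: `c_j = 0` exactly when `j ≡ 5 (mod 6)`** (`p = 3`, `a_3 = ±3`): the residues
`c_0, …, c_4 = 1, a_3, 6, 3a_3, 9` are non-zero, `c_5 = 0`, and `c_{j+6} = −27c_j`. So the Mazur–Tate
element `θ_n` of an X8 curve has FORCED zeros exactly at the layers `k + 1 = n − 5, n − 11, …` (§2).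
[folklore] -/
theorem heckeDescentSeq_eq_zero_iff_of_three {a : ℤ} (ha : a ^ 2 = 9) {c : ℕ → ℤ} (hc0 : c 0 = 1)
    (hc1 : c 1 = a) (hrec : ∀ j, c (j + 2) = a * c (j + 1) - (3 : ℕ) * c j) (j : ℕ) :
    c j = 0 ↔ j % 6 = 5 := by
  have ha0 : a ≠ 0 := by rintro rfl; norm_num at ha
  obtain ⟨h2, h3, h4, h5, -, -⟩ := heckeDescentSeq_values_of_three ha hc0 hc1 hrec
  set q : ℕ := j / 6 with hq
  set s : ℕ := j % 6 with hs
  have hj : j = 6 * q + s := (Nat.div_add_mod j 6).symm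
  have hlt : s < 6 := Nat.mod_lt j (by norm_num)
  rw [hj, heckeDescentSeq_six_mul_add_of_three ha hc0 hc1 hrec, mul_eq_zero]
  have h27 : ((-27 : ℤ)) ^ q ≠ 0 := pow_ne_zero _ (by norm_num)
  simp only [h27, false_or]
  clear_value q s
  interval_cases s
  · simp [hc0]
  · simp [hc1, ha0]
  · simp [h2]
  · simp [h3, ha0]
  · simp [h4]
  · simp [h5]

end Sequence

end Summit.BirchSwinnertonDyer.Rank1Residual.Supersingular
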